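import Summits.BirchSwinnertonDyer.BirchSwinnertonDyer.Theses.ErratumRoadFive
import Summits.BirchSwinnertonDyer.Rank1Residual.X11a.MuLambdaSplit
import Literature.NumberTheory.EllipticCurves.EmertonPollackWeston2006.MuAnTransferMultiplicative
import HarnessLib

/-!
# Crux `NonSurjCornerTwinMuAn` (item 19948): the per-pair certificate `μ^an(E, p) = 0` is an invariant of
# the mod-`p` representation — ρ̄-INVARIANCE DOOR (lane B, seat `bsd-stepL-corner5-p2` g9)

Route `ErratumRoadFive`, crux 6 `NonSurjCorner` (item stmt-BirchSwinnertonDyer-19065), child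
`NonSurjCornerTwinMuAn` (item stmt-BirchSwinnertonDyer-19948; BY NAME = `Theorems.NonSurjCornerTwinMuAn`):
analytic `μ = 0` at every rank-`0` curve of the non-surjective corner shape (`ClassX11a ∧ ¬ Surj ∧
p ∈ {5,7} ∧ p ∣ v_p Δ_min`). Class-wide this is Greenberg's Conjecture 1.11 on the thin family (open in
print); per pair it is a finite exact modular-symbol certificate (lane B census: 328 kernel-rechecked
`MuTable` records, `…TwinMuAnTables*.lean`, bridge `NonSurjTwin.twinMuAn_of_laneCertificates` in `…TwinMuAnOfTables.lean`).

THIS FILE: by Emerton–Pollack–Weston 2006 Theorem 1 (analytic half) WITH `p` IN THE LEVEL — the two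
named facts `EmertonPollackWeston2006.thm1_muAn_transfer_mult_of_multiplicative` /
`…_mult_of_goodOrdinary` (`Literature/…/EmertonPollackWeston2006/MuAnTransferMultiplicative.lean`) —
the certificate `X11a.MuAnZeroAt Wd p` at a member `Wd` of 19948's population FOLLOWS from the same
certificate at ANY globally minimal curve `W₁` with a `Γ_ℚ`-equivariant `W₁[p] ≃ Wd[p]` that is
multiplicative at `p` (`NonSurjTwin.muAnZeroAt_of_torsionIso_mult`) or good ordinary at `p`
(`…_of_torsionIso_good`, certificate in the Néron shape of `thm1_muAn_transfer_of_torsionIso`); and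
conversely one landed certificate at `Wd` certifies the whole mod-`p` congruence class of `Wd` ∩
{multiplicative at `p`} (`NonSurjTwin.muAnZeroAt_congruent_of_member`). Hence (§3) the route decl
19948 ⟸ {the two EPW facts} + «every member is mod-`p` congruent to SOME curve carrying the
certificate» (`NonSurjTwin.twinMuAn_of_congruentCertificates`; converse `congruentCertificates_of_twinMuAn`) — 19948 is a statement about the set of
residual representations {`ρ̄_{E,p}` : `(E, p)` in the population} (at `p = 5`: the mod-5
representations with image in Zywina's `G₉`, lane B g5 `…FiveImageExact`), one certificate per class.
This is the X11a-multiplicative analogue of the `b2b-bsdres` files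
`Rank1Residual/X10/AnalyticMuZeroThreeRhoBarInvariance.lean` (X10b at `p = 3`) and
`Rank1Residual/X9/HessePartnerMuTransfer.lean` (X9), whose EPW fact is typed for GOOD ordinary pairs only.

HONEST FRAMING: CONDITIONAL on the named EPW facts (arguments, never axioms); nothing is proved about any
curve; 19948 class-wide stays OPEN (Greenberg 1.11); closes: none; BSD is proved for no curve or class.
-/

set_option autoImplicit false
set_option linter.dupNamespace false

noncomputable section

open scoped Classical MatrixGroups ModularForm

namespace Summit.BirchSwinnertonDyer.BirchSwinnertonDyer.Theorems

open CongruenceSubgroup WeierstrassCurve Literature.NumberTheory.EllipticCurves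
  Literature.NumberTheory.EllipticCurves.ModularForms
  Literature.NumberTheory.EllipticCurves.Rank1Residual
  Literature.NumberTheory.EllipticCurves.GreenbergVatsal2000
  Literature.NumberTheory.EllipticCurves.EmertonPollackWeston2006
  Summit.BirchSwinnertonDyer.Rank1Residual


/-! ### §0 Bookkeeping: the certificate currency and torsion isomorphisms -/

/-- **`X11a.MuAnZeroAt` unfolded**: the lane certificate at `(W, p)` is literally the `μ^an = 0` clause of
the EPW facts (non-split ∕ split Mazur–Tate–Teitelbaum functions, Néron normalisation). Bookkeeping
(`Iff.rfl`); nothing asserted about any curve. [folklore] -/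
theorem NonSurjTwin.muAnZeroAt_iff_clause (W : WeierstrassCurve ℚ) [W.IsElliptic] [W.IsGloballyMinimal]
    (p : ℕ) [Fact p.Prime] :
    X11a.MuAnZeroAt W p ↔
      ∀ {N : ℕ} [NeZero N] (f : CuspForm (Gamma0 N) 2), IsNewformOf W f →
        ∀ (ϖ : ℚ), (ϖ : ℝ) * W.realPeriodRat = plusPeriod f →
          (¬ W.HasSplitMultiplicativeReductionAtPrime p →
            ∀ L : PowerSeries ℚ_[p], IsMultPAdicLFunctionOf f p (-1) L →
              ∃ n : ℕ, ‖PowerSeries.coeff n (PowerSeries.C ((ϖ : ℚ) : ℚ_[p]) * L)‖ = 1) ∧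
          (W.HasSplitMultiplicativeReductionAtPrime p →
            ∀ L : PowerSeries ℚ_[p], IsSplitMultPAdicLFunctionOf f p L →
              ∃ n : ℕ, ‖PowerSeries.coeff n (PowerSeries.C ((ϖ : ℚ) : ℚ_[p]) * L)‖ = 1) :=
  Iff.rfl

/-- **The two currencies of the Mazur–Tate–Teitelbaum function agree**: the (non-split, split) pair of
clauses of `X11a.MuAnZeroAt` is equivalent to the single clause in the allowable-root currency
`IsMultPAdicLFunctionOf f p a L` (`a = 1` split ∕ `a = -1` non-split) of the route decl
`NonSurjCornerTwinMuAn`, because `IsMultPAdicLFunctionOf f p 1 L ↔ IsSplitMultPAdicLFunctionOf f p L`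
(`isMultPAdicLFunctionOf_one_iff`). Bookkeeping; nothing asserted about any curve. [folklore] -/
theorem NonSurjTwin.muAn_clause_iff_allowableRoot (W : WeierstrassCurve ℚ) [W.IsElliptic]
    [W.IsGloballyMinimal] (p : ℕ) [Fact p.Prime] {N : ℕ} [NeZero N] (f : CuspForm (Gamma0 N) 2) (ϖ : ℚ) :
    ((¬ W.HasSplitMultiplicativeReductionAtPrime p →
        ∀ L : PowerSeries ℚ_[p], IsMultPAdicLFunctionOf f p (-1) L →
          ∃ n : ℕ, ‖PowerSeries.coeff n (PowerSeries.C ((ϖ : ℚ) : ℚ_[p]) * L)‖ = 1) ∧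
      (W.HasSplitMultiplicativeReductionAtPrime p →
        ∀ L : PowerSeries ℚ_[p], IsSplitMultPAdicLFunctionOf f p L →
          ∃ n : ℕ, ‖PowerSeries.coeff n (PowerSeries.C ((ϖ : ℚ) : ℚ_[p]) * L)‖ = 1)) ↔
    ∀ (a : ℚ_[p]) (L : PowerSeries ℚ_[p]),
      (W.HasSplitMultiplicativeReductionAtPrime p → a = 1) →
      (¬ W.HasSplitMultiplicativeReductionAtPrime p → a = -1) →
      IsMultPAdicLFunctionOf f p a L →
      ∃ n : ℕ, ‖PowerSeries.coeff n (PowerSeries.C ((ϖ : ℚ) : ℚ_[p]) * L)‖ = 1 := by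
  constructor
  · rintro ⟨hns, hs⟩ a L hsa hna hL
    by_cases hsplit : W.HasSplitMultiplicativeReductionAtPrime p
    · have ha : a = 1 := hsa hsplit
      subst ha
      exact hs hsplit L ((isMultPAdicLFunctionOf_one_iff L).mp hL)
    · have ha : a = -1 := hna hsplit
      subst ha
      exact hns hsplit L hL
  · intro h
    refine ⟨fun hns L hL => h (-1) L (fun hs => absurd hs hns) (fun _ => rfl) hL, fun hs L hL => ?_⟩
    exact h 1 L (fun _ => rfl) (fun hns => absurd hs hns) ((isMultPAdicLFunctionOf_one_iff L).mpr hL)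

/-- **The inverse of an equivariant torsion isomorphism is equivariant.** Bookkeeping. [folklore] -/
theorem NonSurjTwin.torsionIso_symm_smul {W₁ W₂ : WeierstrassCurve ℚ} {p : ℕ}
    (e : geomTorsion W₁ (p : ℤ) ≃+ geomTorsion W₂ (p : ℤ))
    (he : ∀ (σ : Field.absoluteGaloisGroup ℚ) (P : geomTorsion W₁ (p : ℤ)), e (σ • P) = σ • e P) :
    ∀ (σ : Field.absoluteGaloisGroup ℚ) (Q : geomTorsion W₂ (p : ℤ)), e.symm (σ • Q) = σ • e.symm Q := by
  intro σ Q
  apply e.injective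
  rw [e.apply_symm_apply, he, e.apply_symm_apply]

/-! ### §1 The door at one member: the certificate comes from ANY mod-`p` congruent curve -/

/-- **ρ̄-INVARIANCE, multiplicative source.** At a pair `(Wd, p)` with `Wd` multiplicative at `p ≥ 5` and
`Wd[p]` irreducible (in particular at every member of 19948's population: `ClassX11a Wd p`, `p ∈ {5,7}`),
the lane certificate `X11a.MuAnZeroAt Wd p` FOLLOWS from the same certificate at any globally minimal
`W₁` multiplicative at `p` with a `Γ_ℚ`-equivariant `W₁[p] ≃ Wd[p]` — EPW 2006 Thm. 1 with `p` in the
level (`hEPW`, named fact, by name). CONDITIONAL on `hEPW`; nothing proved about any curve.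
[cite: EmertonPollackWeston2006, Thm. 1 (arXiv:math/0404484 p. 2) and Ex. 5.3.1 (p. 32)] -/
theorem NonSurjTwin.muAnZeroAt_of_torsionIso_mult (hEPW : thm1_muAn_transfer_mult_of_multiplicative)
    (Wd W₁ : WeierstrassCurve ℚ) [Wd.IsElliptic] [Wd.IsGloballyMinimal] [W₁.IsElliptic]
    [W₁.IsGloballyMinimal] (p : ℕ) [Fact p.Prime] (hp : 5 ≤ p)
    (hmult : Mult Wd p) (hirr : Irr Wd p) (hm₁ : W₁.HasMultiplicativeReductionAtPrime p)
    (hiso : ∃ e : geomTorsion W₁ (p : ℤ) ≃+ geomTorsion Wd (p : ℤ),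
      ∀ (σ : Field.absoluteGaloisGroup ℚ) (P : geomTorsion W₁ (p : ℤ)), e (σ • P) = σ • e P)
    (hμ₁ : X11a.MuAnZeroAt W₁ p) : X11a.MuAnZeroAt Wd p := by
  obtain ⟨e, he⟩ := hiso
  have hirr₁ : W₁.HasIrreducibleModPGaloisRep p :=
    hasIrreducibleModPGaloisRep_of_torsionIso e.symm (NonSurjTwin.torsionIso_symm_smul e he) hirr
  intro N _ f hf ϖ hϖ
  exact hEPW W₁ Wd p hp hm₁ hmult ⟨e, he⟩ hirr₁ (fun f₁ hf₁ ϖ₁ hϖ₁ => hμ₁ f₁ hf₁ ϖ₁ hϖ₁) f hf ϖ hϖ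

/-- **ρ̄-INVARIANCE, good-ordinary source.** Same door with `W₁` GOOD ORDINARY at `p` (`GoodOrd W₁ p`),
its certificate read in the Néron shape of `EmertonPollackWeston2006.thm1_muAn_transfer_of_torsionIso`
(for every newform `f₁` of `W₁` at level `N_{W₁}` and every `ϖ₁` with `ϖ₁·Ω_{W₁} = Ω⁺_{f₁}`, some
coefficient of `ϖ₁ · padicLFunction f₁ α` is a `p`-adic unit) — EPW 2006 Thm. 1, good-ordinary member to
`p`-new member (`hEPW`, named fact). CONDITIONAL on `hEPW`; nothing proved about any curve.
[cite: EmertonPollackWeston2006, Thm. 1 (arXiv:math/0404484 p. 2) and Ex. 5.3.1 (p. 32)] -/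
theorem NonSurjTwin.muAnZeroAt_of_torsionIso_good (hEPW : thm1_muAn_transfer_mult_of_goodOrdinary)
    (Wd W₁ : WeierstrassCurve ℚ) [Wd.IsElliptic] [Wd.IsGloballyMinimal] [W₁.IsElliptic]
    [W₁.IsGloballyMinimal] (p : ℕ) [Fact p.Prime] (hp : 5 ≤ p)
    (hmult : Mult Wd p) (hirr : Irr Wd p) (hg₁ : GoodOrd W₁ p)
    (hiso : ∃ e : geomTorsion W₁ (p : ℤ) ≃+ geomTorsion Wd (p : ℤ),
      ∀ (σ : Field.absoluteGaloisGroup ℚ) (P : geomTorsion W₁ (p : ℤ)), e (σ • P) = σ • e P)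
    (hμ₁ : ∀ [NeZero (W₁.conductorNorm ℤ)] (f₁ : CuspForm (Gamma0 (W₁.conductorNorm ℤ)) 2),
        IsNewformOf W₁ f₁ → ∀ (ϖ₁ : ℚ), (ϖ₁ : ℝ) * W₁.realPeriodRat = plusPeriod f₁ →
      ∃ n : ℕ, ‖PowerSeries.coeff n
        (PowerSeries.C (ϖ₁ : ℚ_[p]) * padicLFunction f₁ (unitRoot W₁ p : ℚ_[p]))‖ = 1) :
    X11a.MuAnZeroAt Wd p := by
  obtain ⟨e, he⟩ := hiso
  have hirr₁ : W₁.HasIrreducibleModPGaloisRep p :=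
    hasIrreducibleModPGaloisRep_of_torsionIso e.symm (NonSurjTwin.torsionIso_symm_smul e he) hirr
  intro N _ f hf ϖ hϖ
  exact hEPW W₁ Wd p hp hg₁.1 hg₁.2 hmult ⟨e, he⟩ hirr₁ (fun f₁ hf₁ ϖ₁ hϖ₁ => hμ₁ f₁ hf₁ ϖ₁ hϖ₁) f hf ϖ hϖ

/-- **Conversely, one landed certificate serves the whole congruence class.** If `(Wd, p)` carries the
certificate (`X11a.MuAnZeroAt Wd p`, e.g. from a kernel-rechecked `MuTable` via x11a's door), `Wd`
multiplicative at `p ≥ 5` with `Wd[p]` irreducible, then EVERY globally minimal `W₁` multiplicative at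
`p` with a `Γ_ℚ`-equivariant `Wd[p] ≃ W₁[p]` carries it too — inside or outside the corner. CONDITIONAL
on `hEPW`; nothing proved about any curve.
[cite: EmertonPollackWeston2006, Thm. 1 (arXiv:math/0404484 p. 2) and Ex. 5.3.1 (p. 32)] -/
theorem NonSurjTwin.muAnZeroAt_congruent_of_member (hEPW : thm1_muAn_transfer_mult_of_multiplicative)
    (Wd W₁ : WeierstrassCurve ℚ) [Wd.IsElliptic] [Wd.IsGloballyMinimal] [W₁.IsElliptic]
    [W₁.IsGloballyMinimal] (p : ℕ) [Fact p.Prime] (hp : 5 ≤ p)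
    (hmult : Mult Wd p) (hirr : Irr Wd p) (hm₁ : W₁.HasMultiplicativeReductionAtPrime p)
    (hiso : ∃ e : geomTorsion Wd (p : ℤ) ≃+ geomTorsion W₁ (p : ℤ),
      ∀ (σ : Field.absoluteGaloisGroup ℚ) (P : geomTorsion Wd (p : ℤ)), e (σ • P) = σ • e P)
    (hμ : X11a.MuAnZeroAt Wd p) : X11a.MuAnZeroAt W₁ p := by
  obtain ⟨e, he⟩ := hiso
  intro N _ f hf ϖ hϖ
  exact hEPW Wd W₁ p hp hmult hm₁ ⟨e, he⟩ hirr (fun f₁ hf₁ ϖ₁ hϖ₁ => hμ f₁ hf₁ ϖ₁ hϖ₁) f hf ϖ hϖ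

/-! ### §2 The population: 19948 is a statement about residual representations -/

/-- **19948 from one certificate per mod-`p` congruence class.** Modulo the two EPW facts (by name), the
route decl `Theses.ErratumRoadFive.NonSurjCornerTwinMuAn` follows from «every member `(Wd, p)` of the
population is mod-`p` congruent (a `Γ_ℚ`-equivariant `W₁[p] ≃ Wd[p]`) to SOME globally minimal `W₁` that is
EITHER multiplicative at `p` carrying the lane certificate `X11a.MuAnZeroAt W₁ p` OR good ordinary at `p`
carrying the Néron-shape certificate» (taking `W₁ := Wd` shows 19948 implies this hypothesis:
`congruentCertificates_of_twinMuAn`):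
at each member the certificate is moved along the congruence (§1) and then read in the decl's allowable-root
currency (`muAn_clause_iff_allowableRoot`; = corner-p1's bridge `NonSurjTwin.twinMuAn_of_laneCertificates`, inlined). The `∀` over residual classes is what stays OPEN (Greenberg
Conj. 1.11 on the family of mod-`p` representations with image in `G₉` at `p = 5` ∕ in `N(C_s(7))` at
`p = 7`); per class one finite certificate. CONDITIONAL; nothing booked; closes: none.
[cite: EmertonPollackWeston2006, Thm. 1 (arXiv:math/0404484 p. 2)] [cite: GreenbergLNM1716, §1 Conj. 1.11 (p. 61)] -/
theorem NonSurjTwin.twinMuAn_of_congruentCertificates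
    (hEPWm : thm1_muAn_transfer_mult_of_multiplicative) (hEPWg : thm1_muAn_transfer_mult_of_goodOrdinary)
    (h : ∀ (Wd : WeierstrassCurve ℚ) [Wd.IsElliptic] [Wd.IsGloballyMinimal] (p : ℕ) [Fact p.Prime],
      ClassX11a Wd p → ¬ Surj Wd p → (p = 5 ∨ p = 7) → p ∣ padicValInt p Wd.minimalDiscriminantInt →
      ∃ (W₁ : WeierstrassCurve ℚ) (_ : W₁.IsElliptic) (_ : W₁.IsGloballyMinimal),
        (∃ e : geomTorsion W₁ (p : ℤ) ≃+ geomTorsion Wd (p : ℤ),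
          ∀ (σ : Field.absoluteGaloisGroup ℚ) (P : geomTorsion W₁ (p : ℤ)), e (σ • P) = σ • e P) ∧
        ((W₁.HasMultiplicativeReductionAtPrime p ∧ X11a.MuAnZeroAt W₁ p) ∨
         (GoodOrd W₁ p ∧
          ∀ [NeZero (W₁.conductorNorm ℤ)] (f₁ : CuspForm (Gamma0 (W₁.conductorNorm ℤ)) 2),
            IsNewformOf W₁ f₁ → ∀ (ϖ₁ : ℚ), (ϖ₁ : ℝ) * W₁.realPeriodRat = plusPeriod f₁ →
          ∃ n : ℕ, ‖PowerSeries.coeff n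
            (PowerSeries.C (ϖ₁ : ℚ_[p]) * padicLFunction f₁ (unitRoot W₁ p : ℚ_[p]))‖ = 1))) :
    Summit.BirchSwinnertonDyer.BirchSwinnertonDyer.Theses.ErratumRoadFive.NonSurjCornerTwinMuAn := by
  -- the route decl is `Theorems.NonSurjCornerTwinMuAn`; read its allowable-root clause from the lane
  -- certificate at each member (as corner-p1's `NonSurjTwin.twinMuAn_of_laneCertificates`, inlined to keep
  -- this file off the Theorems-on-Theses cone)
  show Summit.BirchSwinnertonDyer.BirchSwinnertonDyer.Theorems.NonSurjCornerTwinMuAn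
  intro Wd _ _ p _ hXa hns h57 hv
  have hp : 5 ≤ p := by rcases h57 with rfl | rfl <;> omega
  obtain ⟨W₁, _, _, hiso, hW₁⟩ := h Wd p hXa hns h57 hv
  -- the lane certificate at `Wd`, moved along the congruence (§1); the certificate `Prop`s unfold to
  -- `∀ {N} [NeZero N] …`, so they are kept unapplied with `@` and the goal is read unfolded
  have key : X11a.MuAnZeroAt Wd p := by
    rcases hW₁ with ⟨hm₁, hμ₁⟩ | ⟨hg₁, hμ₁⟩
    · rw [NonSurjTwin.muAnZeroAt_iff_clause]
      intro N _ f hf ϖ hϖ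
      exact NonSurjTwin.muAnZeroAt_of_torsionIso_mult hEPWm Wd W₁ p hp hXa.2.2.1 hXa.2.2.2.1 hm₁ hiso @hμ₁
        f hf ϖ hϖ
    · rw [NonSurjTwin.muAnZeroAt_iff_clause]
      intro N _ f hf ϖ hϖ
      exact NonSurjTwin.muAnZeroAt_of_torsionIso_good hEPWg Wd W₁ p hp hXa.2.2.1 hXa.2.2.2.1 hg₁ hiso @hμ₁
        f hf ϖ hϖ
  intro N _ f hf ϖ hϖ
  exact (NonSurjTwin.muAn_clause_iff_allowableRoot Wd p f ϖ).mp (key f hf ϖ hϖ)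

/-- **The converse bookkeeping**: 19948 implies the hypothesis of `twinMuAn_of_congruentCertificates`
(take `W₁ := Wd` and the identity isomorphism, reading the route decl's body back as the lane certificate via
`muAn_clause_iff_allowableRoot`) — so, modulo the two EPW facts, 19948 is EQUIVALENT to «one certificate per
mod-`p` congruence class of the population». Nothing asserted about any curve. [folklore] -/
theorem NonSurjTwin.congruentCertificates_of_twinMuAn
    (h : Summit.BirchSwinnertonDyer.BirchSwinnertonDyer.Theses.ErratumRoadFive.NonSurjCornerTwinMuAn) :
    ∀ (Wd : WeierstrassCurve ℚ) [Wd.IsElliptic] [Wd.IsGloballyMinimal] (p : ℕ) [Fact p.Prime],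
      ClassX11a Wd p → ¬ Surj Wd p → (p = 5 ∨ p = 7) → p ∣ padicValInt p Wd.minimalDiscriminantInt →
      ∃ (W₁ : WeierstrassCurve ℚ) (_ : W₁.IsElliptic) (_ : W₁.IsGloballyMinimal),
        (∃ e : geomTorsion W₁ (p : ℤ) ≃+ geomTorsion Wd (p : ℤ),
          ∀ (σ : Field.absoluteGaloisGroup ℚ) (P : geomTorsion W₁ (p : ℤ)), e (σ • P) = σ • e P) ∧
        ((W₁.HasMultiplicativeReductionAtPrime p ∧ X11a.MuAnZeroAt W₁ p) ∨
         (GoodOrd W₁ p ∧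
          ∀ [NeZero (W₁.conductorNorm ℤ)] (f₁ : CuspForm (Gamma0 (W₁.conductorNorm ℤ)) 2),
            IsNewformOf W₁ f₁ → ∀ (ϖ₁ : ℚ), (ϖ₁ : ℝ) * W₁.realPeriodRat = plusPeriod f₁ →
          ∃ n : ℕ, ‖PowerSeries.coeff n
            (PowerSeries.C (ϖ₁ : ℚ_[p]) * padicLFunction f₁ (unitRoot W₁ p : ℚ_[p]))‖ = 1)) := by
  intro Wd _ _ p _ hXa hns h57 hv
  refine ⟨Wd, inferInstance, inferInstance, ⟨AddEquiv.refl _, fun σ P => rfl⟩, Or.inl ⟨hXa.2.2.1, ?_⟩⟩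
  intro N _ f hf ϖ hϖ
  rw [NonSurjTwin.muAn_clause_iff_allowableRoot]
  intro a L hsa hna hL
  exact h Wd p hXa hns h57 hv f hf ϖ hϖ a L hsa hna hL

end Summit.BirchSwinnertonDyer.BirchSwinnertonDyer.Theorems

end
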